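import Mathlib
import HarnessLib
import Literature.NumberTheory.GaloisRepresentations.EnormousSubgroup
import Literature.NumberTheory.GaloisRepresentations.ProjectiveTypeSolvable
import Literature.NumberTheory.GaloisRepresentations.DihedralTypeMonomialAnyChar
import Literature.NumberTheory.GaloisRepresentations.AdequateOfCoprimeOrder
import Summits.Langlands.Langlands.Theorems.RamifiedCoefficientSeedAdjointLiftingGL3StubEnormousAdTransfer

/-!
# Stub `stub_enormousResidualPackage` of crux `TensorSquareParallel` (stmt-Langlands-17009), line
# `merged` — helper 2: an absolutely irreducible dihedral subgroup of `GL₂(k)` of order prime to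
# `p = char k ≠ 2` is enormous (ACC+ Def. 6.2.28)

Crux `stmt-Langlands-17009` = `Summit.Langlands.Langlands.Theses.NonParallelVoid.TensorSquareParallel`
(line `merged`; stub `stub_enormousResidualPackage` supplies hypotheses (iii)–(iv) of Qian 2023,
Thm. 1.4 in the projectively dihedral, nearly ordinary corner).  This file PROVES (no named fact)
the "lemma with teeth" of that stub, as pure group theory: for `k` algebraically closed of
characteristic `p ≠ 2` whose units have finite order prime to `p` (e.g. `k = 𝔽̄_p = ℤ̄_p/𝔪`), a
homomorphism `r : G → GL₂(k)` with finite image of order prime to `p`, absolutely irreducible and of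
dihedral type (`IsDihedralType`: projective image `≅ D_m`, `m ≥ 2`), has ENORMOUS image in the
sense of ACC+ Def. 6.2.28 (tree `Subgroup.IsEnormous`: (1) no `p`-power quotient, (2) `(ad⁰)^H = 0`
and `H¹(H, ad⁰) = 0`, (3) every simple `k[H]`-submodule of `ad⁰` has a non-zero vector fixed by a
regular semisimple element of `H`).

* §1 `conj_of_isDg`, `conj_of_isAd`, `combination_conj_of_isDg`, `isRegularSemisimple_of_isDg/Ad` —
  `2 × 2` bookkeeping: conjugation of `M₂(k)` by diagonal / antidiagonal elements, separability of
  `(X-a)(X-b)` (`a ≠ b`) and of `X² - xy` (`p ≠ 2`).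
* §2 `isEnormous_range_of_monomial` — the three clauses for a MONOMIAL `r` (diagonal on a subgroup
  `G'`, antidiagonal off `G' ≠ G`, some `diag(a, b)`, `a ≠ b`, on `G'`); (2b) is the averaging
  argument `|H| ∈ kˣ` (tree `MonomialAdequacy.exists_eq_sub_of_subgroup`).
* §3 `isEnormous_range_of_isDihedralType` — the general statement, through the monomial normal form
  (tree `exists_monomial_of_isDihedralType_of_not_hasCommonEigenvector`, Khare–Wintenberger 2009
  §6) and "enormous only depends on the image in `PGL₂` up to conjugation" (tree
  `isEnormous_of_forall_exists_eq_scalar_mul_conj`, ACC+ remark after Def. 6.2.28);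
  `stub_enormousResidualPackage_enormousOfDihedral` — the same as a closed formula (the sub-goal
  registered on the crux item for this file).

## References

* [ACCGHLNSTT2023] P. B. Allen et al., *Potential automorphy over CM fields*, Ann. of Math. 197
  (2023) = arXiv:1812.09999, Def. 6.2.28 and the remark following it.
* [KhareWintenberger2009] C. Khare, J.-P. Wintenberger, Invent. Math. 178 (2009), §6, Lemma 6.3.
-/

set_option linter.dupNamespace false

noncomputable section

namespace Summit.Langlands.Langlands.Theorems.TensorSquareParallel

open scoped MatrixGroups Polynomial
open Matrix Polynomial Literature.NumberTheory.GaloisRepresentations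
open Summit.Langlands.Langlands.Cruxes.AdjointLiftingGL3.Birth

universe u v

/-! ## §1. `2 × 2` matrix lemmas: conjugation by diagonal and antidiagonal elements -/
section Matrices

variable {k : Type u} [Field k]

local notation "M₂" => Matrix (Fin 2) (Fin 2) k

/-- **Conjugation by a diagonal `D = diag(a, b)`**: `D M D⁻¹ = (a_i M_{ij} / a_j)`. [folklore] -/
theorem conj_of_isDg (D : GL (Fin 2) k) (hD : GL2.IsDg (D : M₂)) (M : M₂) :
    (D : M₂) * M * ((D⁻¹ : GL (Fin 2) k) : M₂) =
      !![M 0 0, (D : M₂) 0 0 * M 0 1 * ((D : M₂) 1 1)⁻¹;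
         (D : M₂) 1 1 * M 1 0 * ((D : M₂) 0 0)⁻¹, M 1 1] := by
  obtain ⟨ha, hb⟩ := GL2.IsDg.entry_ne_zero hD (GL2.det_ne_zero D)
  have h1 : (D : M₂) = !![(D : M₂) 0 0, 0; 0, (D : M₂) 1 1] := by
    ext i j; fin_cases i <;> fin_cases j <;> simp [hD.1, hD.2]
  have h2 : ((D⁻¹ : GL (Fin 2) k) : M₂) = !![((D : M₂) 0 0)⁻¹, 0; 0, ((D : M₂) 1 1)⁻¹] := by
    rw [Matrix.coe_units_inv]
    nth_rw 1 [h1]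
    refine Matrix.inv_eq_left_inv ?_
    rw [Matrix.mul_fin_two, Matrix.one_fin_two]
    congr 1; simp [ha, hb]
  rw [h2]
  nth_rw 1 [h1]
  rw [Matrix.eta_fin_two M, Matrix.mul_fin_two, Matrix.mul_fin_two]
  congr 1; simp [ha, hb, mul_comm ((D : M₂) 0 0), mul_comm ((D : M₂) 1 1)]

/-- **Conjugation by an antidiagonal `A = (0 x; y 0)`**:
`A M A⁻¹ = (M₁₁, x M₁₀ / y; y M₀₁ / x, M₀₀)`. [folklore] -/
theorem conj_of_isAd (A : GL (Fin 2) k) (hA : GL2.IsAd (A : M₂)) (M : M₂) :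
    (A : M₂) * M * ((A⁻¹ : GL (Fin 2) k) : M₂) =
      !![M 1 1, (A : M₂) 0 1 * M 1 0 * ((A : M₂) 1 0)⁻¹;
         (A : M₂) 1 0 * M 0 1 * ((A : M₂) 0 1)⁻¹, M 0 0] := by
  obtain ⟨hx, hy⟩ := GL2.IsAd.entry_ne_zero hA (GL2.det_ne_zero A)
  have h1 : (A : M₂) = !![0, (A : M₂) 0 1; (A : M₂) 1 0, 0] := by
    ext i j; fin_cases i <;> fin_cases j <;> simp [hA.1, hA.2]
  have h2 : ((A⁻¹ : GL (Fin 2) k) : M₂) = !![0, ((A : M₂) 1 0)⁻¹; ((A : M₂) 0 1)⁻¹, 0] := by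
    rw [Matrix.coe_units_inv]
    nth_rw 1 [h1]
    refine Matrix.inv_eq_left_inv ?_
    rw [Matrix.mul_fin_two, Matrix.one_fin_two]
    congr 1; simp [hx, hy]
  rw [h2]
  nth_rw 1 [h1]
  rw [Matrix.eta_fin_two M, Matrix.mul_fin_two, Matrix.mul_fin_two]
  congr 1; simp [hx, hy, mul_comm ((A : M₂) 0 1), mul_comm ((A : M₂) 1 0)]

/-- A diagonal element of `GL₂(k)` with distinct diagonal entries is regular semisimple: its
characteristic polynomial `(X - a)(X - b)` is separable. [folklore] -/
theorem isRegularSemisimple_of_isDg (D : GL (Fin 2) k) (hD : GL2.IsDg (D : M₂))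
    (hab : (D : M₂) 0 0 ≠ (D : M₂) 1 1) : IsRegularSemisimple D := by
  rw [isRegularSemisimple_iff, Matrix.charpoly_fin_two, GL2.det_of_isDg hD, Matrix.trace_fin_two]
  have e : (X ^ 2 - C ((D : M₂) 0 0 + (D : M₂) 1 1) * X + C ((D : M₂) 0 0 * (D : M₂) 1 1) : k[X]) =
      (X - C ((D : M₂) 0 0)) * (X - C ((D : M₂) 1 1)) := by
    simp only [map_add, map_mul]
    ring
  rw [e]
  exact (Polynomial.separable_X_sub_C).mul Polynomial.separable_X_sub_C
    (Polynomial.isCoprime_X_sub_C_of_isUnit_sub (sub_ne_zero.2 hab).isUnit)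

/-- An antidiagonal element of `GL₂(k)`, `char k ≠ 2`, is regular semisimple: its characteristic
polynomial `X² - xy` is separable. [folklore] -/
theorem isRegularSemisimple_of_isAd (h2 : (2 : k) ≠ 0) (A : GL (Fin 2) k)
    (hA : GL2.IsAd (A : M₂)) : IsRegularSemisimple A := by
  obtain ⟨hx, hy⟩ := GL2.IsAd.entry_ne_zero hA (GL2.det_ne_zero A)
  rw [isRegularSemisimple_iff, Matrix.charpoly_fin_two, GL2.det_of_isAd hA, Matrix.trace_fin_two,
    hA.1, hA.2, add_zero, map_zero, zero_mul, sub_zero, map_neg, ← sub_eq_add_neg]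
  exact Polynomial.separable_X_pow_sub_C _ (by exact_mod_cast h2) (mul_ne_zero hx hy)

/-- The combination `ab · Ad_D²(M) - (a² + b²) · Ad_D(M) + ab · M`, `D = diag(a, b)`, kills the
off-diagonal part of `M` and multiplies its diagonal part by `-(a - b)²` (the operator
`(Ad_D - a/b)(Ad_D - b/a)` on `M₂(k)`, cleared of denominators). [folklore] -/
theorem combination_conj_of_isDg (D : GL (Fin 2) k) (hD : GL2.IsDg (D : M₂)) (M : M₂) :
    ((D : M₂) 0 0 * (D : M₂) 1 1) •
        ((D : M₂) * ((D : M₂) * M * ((D⁻¹ : GL (Fin 2) k) : M₂)) * ((D⁻¹ : GL (Fin 2) k) : M₂)) -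
      ((D : M₂) 0 0 ^ 2 + (D : M₂) 1 1 ^ 2) • ((D : M₂) * M * ((D⁻¹ : GL (Fin 2) k) : M₂)) +
      ((D : M₂) 0 0 * (D : M₂) 1 1) • M =
      !![-((D : M₂) 0 0 - (D : M₂) 1 1) ^ 2 * M 0 0, 0;
         0, -((D : M₂) 0 0 - (D : M₂) 1 1) ^ 2 * M 1 1] := by
  obtain ⟨ha, hb⟩ := GL2.IsDg.entry_ne_zero hD (GL2.det_ne_zero D)
  rw [conj_of_isDg D hD, conj_of_isDg D hD]
  nth_rw 5 [Matrix.eta_fin_two M]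
  ext i j
  fin_cases i <;> fin_cases j <;> simp <;> field_simp <;> ring

end Matrices

/-! ## §2. A monomial absolutely irreducible subgroup of order prime to `p` is enormous -/
section Monomial

variable {k : Type u} [Field k] {p : ℕ} [Fact p.Prime] [CharP k p] {G : Type v} [Group G]

local notation "M₂" => Matrix (Fin 2) (Fin 2) k
local notation "adGL" => Subrepresentation.toRepresentation (adZero (Fin 2) k)

omit [Fact p.Prime] [CharP k p] in
/-- For an antidiagonal `A ∈ GL₂(k)` (`A²` scalar, so `Ad A` is an involution of `ad⁰`), every
`w + Ad_A w` is fixed by `Ad A`. [folklore] -/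
theorem adGL_apply_add_adGL_apply (A : GL (Fin 2) k) (hA : GL2.IsAd (A : M₂))
    (w : (adZero (Fin 2) k).toSubmodule) : adGL A (w + adGL A w) = w + adGL A w := by
  obtain ⟨hx, hy⟩ := GL2.IsAd.entry_ne_zero hA (GL2.det_ne_zero A)
  have hsq : adGL (A * A) = 1 := by
    have e : A * A = GeneralLinearGroup.scalar (Fin 2) (Units.mk0 _ (mul_ne_zero hx hy)) := by
      refine Units.ext ?_
      rw [Units.val_mul, GL2.IsAd.mul_self hA, GeneralLinearGroup.coe_scalar, Matrix.scalar_apply,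
        Matrix.smul_one_eq_diagonal, Units.val_mk0]
    rw [e, adGL_scalar]
  rw [map_add, ← Module.End.mul_apply, ← map_mul, hsq, Module.End.one_apply, add_comm]

omit [Fact p.Prime] [CharP k p] in
/-- The `(0,1)` entry of `w + Ad_A w` for `A` antidiagonal and `w` with zero diagonal:
`(y w₀₁ + x w₁₀) / y`. [folklore] -/
theorem coe_add_adGL_apply_zero_one (A : GL (Fin 2) k) (hA : GL2.IsAd (A : M₂))
    (w : (adZero (Fin 2) k).toSubmodule) :
    ((w + adGL A w : (adZero (Fin 2) k).toSubmodule) : M₂) 0 1 =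
      ((A : M₂) 1 0 * (w : M₂) 0 1 + (A : M₂) 0 1 * (w : M₂) 1 0) * ((A : M₂) 1 0)⁻¹ := by
  obtain ⟨hx, hy⟩ := GL2.IsAd.entry_ne_zero hA (GL2.det_ne_zero A)
  rw [Submodule.coe_add, coe_adGL_apply, conj_of_isAd A hA, Matrix.add_apply]
  simp only [Matrix.of_apply, Matrix.cons_val', Matrix.cons_val_zero, Matrix.cons_val_one,
    Matrix.cons_val_fin_one]
  field_simp

/-- **A monomial `H = r(G) ≤ GL₂(k)` of order prime to `p = char k ≠ 2` is enormous** (ACC+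
Def. 6.2.28): `r` diagonal on a subgroup `G'`, antidiagonal off `G' ≠ G`, some `r(h₀) = diag(a, b)`,
`a ≠ b`, `h₀ ∈ G'`.  (1): a quotient of order `p^n`, `n ≥ 1`, would give `p ∣ |H|`.  (2a): an
`H`-invariant `M ∈ ad⁰` commutes with `diag(a, b)` (so is diagonal) and with an antidiagonal element
(so is scalar), hence `M = 0` (trace `0`, `p ≠ 2`).  (2b): averaging over `H`, `|H| ∈ kˣ`
(`MonomialAdequacy.exists_eq_sub_of_subgroup`).  (3): for `0 ≠ w ∈ W`, either
`ab·Ad_D² w - (a²+b²)·Ad_D w + ab·w = -(a-b)² · (diagonal part of w) ≠ 0` is fixed by `D = r(h₀)`, or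
`w` is antidiagonal and `w + Ad_A w ≠ 0` is fixed by the antidiagonal (regular semisimple) `A = r(g₀)`
or, if that vector vanishes, by `D A`. [cite: ACCGHLNSTT2023, Def. 6.2.28] -/
theorem isEnormous_range_of_monomial (hp2 : p ≠ 2) (r : G →* GL (Fin 2) k) [Finite r.range]
    (hcard : ¬ p ∣ Nat.card r.range) (G' : Subgroup G)
    (hDg : ∀ g, g ∈ G' → GL2.IsDg ((r g : GL (Fin 2) k) : M₂))
    (hAd : ∀ g, g ∉ G' → GL2.IsAd ((r g : GL (Fin 2) k) : M₂))
    {h₀ : G} (hh₀ : h₀ ∈ G')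
    (hab : ((r h₀ : GL (Fin 2) k) : M₂) 0 0 ≠ ((r h₀ : GL (Fin 2) k) : M₂) 1 1)
    {g₀ : G} (hg₀ : g₀ ∉ G') : Subgroup.IsEnormous r.range := by
  classical
  have hp : p.Prime := Fact.out
  have htwo : (2 : k) ≠ 0 := fun h ↦ by
    have h' : ((2 : ℕ) : k) = 0 := by exact_mod_cast h
    exact hp2 ((Nat.prime_dvd_prime_iff_eq hp Nat.prime_two).1 ((CharP.cast_eq_zero_iff k p _).1 h'))
  have hcast : ((Nat.card r.range : ℕ) : k) ≠ 0 := fun h ↦ hcard ((CharP.cast_eq_zero_iff k p _).1 h)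
  set H : Subgroup (GL (Fin 2) k) := r.range with hH
  set D : GL (Fin 2) k := r h₀ with hDdef
  set A : GL (Fin 2) k := r g₀ with hAdef
  have hD : GL2.IsDg (D : M₂) := hDg h₀ hh₀
  have hA : GL2.IsAd (A : M₂) := hAd g₀ hg₀
  obtain ⟨ha, hb⟩ := GL2.IsDg.entry_ne_zero hD (GL2.det_ne_zero D)
  obtain ⟨hx, hy⟩ := GL2.IsAd.entry_ne_zero hA (GL2.det_ne_zero A)
  have hDH : D ∈ H := ⟨h₀, rfl⟩
  have hAH : A ∈ H := ⟨g₀, rfl⟩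
  have hDAH : D * A ∈ H := H.mul_mem hDH hAH
  have hDA : GL2.IsAd ((D * A : GL (Fin 2) k) : M₂) := by
    rw [Units.val_mul]; exact hD.mul_isAd hA
  refine ⟨fun N _ n hN ↦ ?_, ?_, ?_, fun W hW ↦ ?_⟩
  · -- (1) no non-trivial quotient of `p`-power order
    by_contra hn
    have h1 : p ∣ Nat.card (H ⧸ N) := by
      rw [hN, ringChar.eq k p]; exact dvd_pow_self p hn
    exact hcard (h1.trans (Subgroup.card_quotient_dvd_card N))
  · -- (2a) `(ad⁰)^H = 0`
    rw [eq_bot_iff]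
    intro M hM
    rw [Representation.mem_invariants] at hM
    rw [Submodule.mem_bot]
    have h1 : (D : M₂) * (M : M₂) * ((D⁻¹ : GL (Fin 2) k) : M₂) = M :=
      congrArg Subtype.val (hM ⟨D, hDH⟩)
    have h2 : (A : M₂) * (M : M₂) * ((A⁻¹ : GL (Fin 2) k) : M₂) = M :=
      congrArg Subtype.val (hM ⟨A, hAH⟩)
    rw [conj_of_isAd A hA] at h2
    have htr : (M : M₂) 0 0 + (M : M₂) 1 1 = 0 := by rw [← Matrix.trace_fin_two]; exact M.2
    have e00 : (M : M₂) 1 1 = (M : M₂) 0 0 := congrFun (congrFun h2 0) 0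
    -- `M` commutes with `D = diag(a, b)`, `a ≠ b`, hence is diagonal
    have hcomm : (M : M₂) * diagonal ![(D : M₂) 0 0, (D : M₂) 1 1] =
        diagonal ![(D : M₂) 0 0, (D : M₂) 1 1] * M := by
      rw [← hD.eq_diagonal]
      calc (M : M₂) * D = (D : M₂) * M * ((D⁻¹ : GL (Fin 2) k) : M₂) * D := by rw [h1]
        _ = (D : M₂) * M := by rw [Matrix.mul_assoc, Units.inv_mul, Matrix.mul_one]
    obtain ⟨hM01, hM10⟩ := GL2.isDg_of_commute_diagonal (x := (M : M₂)) hab hcomm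
    have hM00 : (M : M₂) 0 0 = 0 := by
      rw [e00, ← two_mul] at htr
      exact (mul_eq_zero.1 htr).resolve_left htwo
    refine Subtype.ext ?_
    rw [Matrix.eta_fin_two (M : M₂), hM01, hM10, e00, hM00]
    ext i j; fin_cases i <;> fin_cases j <;> rfl
  · -- (2b) `H¹(H, ad⁰) = 0`: average over `H`
    rw [cocycles₁_le_coboundaries₁_iff_forall]
    intro f hf
    change ∀ g h : H, f (g * h) = Subgroup.adZeroRep H g (f h) + f g at hf
    change ∃ m, ∀ g : H, f g = Subgroup.adZeroRep H g m - m
    haveI : (⊥ : Subgroup H).FiniteIndex := inferInstance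
    refine MonomialAdequacy.exists_eq_sub_of_subgroup _ ⊥ (by rwa [Subgroup.index_bot]) f hf
      ⟨0, fun x hx ↦ ?_⟩
    rw [Subgroup.mem_bot] at hx
    rw [hx, map_one, map_zero, sub_zero]
    exact MonomialAdequacy.cocycle_apply_one _ f hf
  · -- (3) a regular semisimple element with a fixed vector in the simple submodule `W`
    have hWne : W.toSubmodule ≠ ⊥ := fun h ↦ hW.1 (Subrepresentation.toSubmodule_injective h)
    obtain ⟨w, hwW, hw0⟩ := Submodule.exists_mem_ne_zero_of_ne_bot hWne
    have hstab : ∀ {z : GL (Fin 2) k}, z ∈ H → ∀ {v : (adZero (Fin 2) k).toSubmodule},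
        v ∈ W.toSubmodule → adGL z v ∈ W.toSubmodule :=
      fun hz v hv ↦ W.apply_mem_toSubmodule ⟨_, hz⟩ hv
    have htr : (w : M₂) 0 0 + (w : M₂) 1 1 = 0 := by rw [← Matrix.trace_fin_two]; exact w.2
    by_cases h00 : (w : M₂) 0 0 = 0
    · -- `w` is antidiagonal
      have h11 : (w : M₂) 1 1 = 0 := by rwa [h00, zero_add] at htr
      have hw01 : (w : M₂) 0 1 ≠ 0 ∨ (w : M₂) 1 0 ≠ 0 := by
        by_contra! hboth
        apply hw0
        refine Subtype.ext ?_
        rw [Matrix.eta_fin_two (w : M₂), h00, h11, hboth.1, hboth.2]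
        ext i j; fin_cases i <;> fin_cases j <;> rfl
      by_cases hβγ : (A : M₂) 1 0 * (w : M₂) 0 1 + (A : M₂) 0 1 * (w : M₂) 1 0 = 0
      · -- use the antidiagonal `D A`
        refine ⟨⟨D * A, hDAH⟩, isRegularSemisimple_of_isAd htwo _ hDA, w + adGL (D * A) w,
          W.toSubmodule.add_mem hwW (hstab hDAH hwW), fun h0 ↦ ?_,
          adGL_apply_add_adGL_apply _ hDA w⟩
        have e := coe_add_adGL_apply_zero_one (D * A) hDA w
        rw [h0] at e
        have hDA10 : ((D * A : GL (Fin 2) k) : M₂) 1 0 = (D : M₂) 1 1 * (A : M₂) 1 0 := by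
          rw [Units.val_mul, GL2.mul_fin_two, hD.2, zero_mul, zero_add]
        have hDA01 : ((D * A : GL (Fin 2) k) : M₂) 0 1 = (D : M₂) 0 0 * (A : M₂) 0 1 := by
          rw [Units.val_mul, GL2.mul_fin_two, hD.1, zero_mul, add_zero]
        rw [ZeroMemClass.coe_zero, Matrix.zero_apply, hDA10, hDA01, eq_comm, mul_eq_zero,
          inv_eq_zero] at e
        rcases e with e | e
        · -- `b y w₀₁ + a x w₁₀ = 0` and `y w₀₁ + x w₁₀ = 0` force `a = b` or `w = 0`
          have e1 : (A : M₂) 0 1 * (w : M₂) 1 0 = -((A : M₂) 1 0 * (w : M₂) 0 1) := by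
            linear_combination hβγ
          have e2 : ((D : M₂) 1 1 - (D : M₂) 0 0) * ((A : M₂) 1 0 * (w : M₂) 0 1) = 0 := by
            linear_combination e - (D : M₂) 0 0 * hβγ
          rcases mul_eq_zero.1 e2 with e3 | e3
          · exact hab (sub_eq_zero.1 e3).symm
          · rcases mul_eq_zero.1 e3 with e4 | e4
            · exact hy e4
            · rw [e4, mul_zero, neg_zero] at e1
              rcases mul_eq_zero.1 e1 with e5 | e5
              · exact hx e5
              · rcases hw01 with h | h
                · exact h e4
                · exact h e5
        · exact mul_ne_zero hb hy e
      · -- use `A`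
        refine ⟨⟨A, hAH⟩, isRegularSemisimple_of_isAd htwo A hA, w + adGL A w,
          W.toSubmodule.add_mem hwW (hstab hAH hwW), fun h0 ↦ ?_, adGL_apply_add_adGL_apply A hA w⟩
        have e := coe_add_adGL_apply_zero_one A hA w
        rw [h0, ZeroMemClass.coe_zero, Matrix.zero_apply, eq_comm, mul_eq_zero, inv_eq_zero] at e
        rcases e with e | e
        · exact hβγ e
        · exact hy e
    · -- the diagonal part of `w` is non-zero: use `D`
      set N : (adZero (Fin 2) k).toSubmodule :=
        ((D : M₂) 0 0 * (D : M₂) 1 1) • adGL D (adGL D w) -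
          ((D : M₂) 0 0 ^ 2 + (D : M₂) 1 1 ^ 2) • adGL D w +
          ((D : M₂) 0 0 * (D : M₂) 1 1) • w with hNdef
      have hNval : (N : M₂) = !![-((D : M₂) 0 0 - (D : M₂) 1 1) ^ 2 * (w : M₂) 0 0, 0;
          0, -((D : M₂) 0 0 - (D : M₂) 1 1) ^ 2 * (w : M₂) 1 1] := by
        simp only [hNdef, Submodule.coe_add, Submodule.coe_sub, Submodule.coe_smul, coe_adGL_apply]
        exact combination_conj_of_isDg D hD (w : M₂)
      have hNW : N ∈ W.toSubmodule :=
        W.toSubmodule.add_mem (W.toSubmodule.sub_mem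
          (W.toSubmodule.smul_mem _ (hstab hDH (hstab hDH hwW)))
          (W.toSubmodule.smul_mem _ (hstab hDH hwW))) (W.toSubmodule.smul_mem _ hwW)
      refine ⟨⟨D, hDH⟩, isRegularSemisimple_of_isDg D hD hab, N, hNW, fun h0 ↦ ?_, ?_⟩
      · have e : (N : M₂) 0 0 = 0 := by rw [h0, ZeroMemClass.coe_zero, Matrix.zero_apply]
        rw [hNval] at e
        change -((D : M₂) 0 0 - (D : M₂) 1 1) ^ 2 * (w : M₂) 0 0 = 0 at e
        rcases mul_eq_zero.1 e with e | e
        · exact hab (sub_eq_zero.1 (pow_eq_zero_iff two_ne_zero |>.1 (neg_eq_zero.1 e)))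
        · exact h00 e
      · refine Subtype.ext ?_
        change (D : M₂) * (N : M₂) * ((D⁻¹ : GL (Fin 2) k) : M₂) = N
        rw [conj_of_isDg D hD, hNval]
        ext i j; fin_cases i <;> fin_cases j <;> simp

end Monomial

/-! ## §3. Absolutely irreducible of dihedral type and order prime to `p` ⟹ enormous -/
section Dihedral

variable {k : Type u} [Field k] [IsAlgClosed k] {p : ℕ} [Fact p.Prime] [CharP k p]
variable {G : Type v} [Group G]

/-- **An absolutely irreducible `r : G → GL₂(k)` of dihedral type with finite image of order prime
to `p = char k ≠ 2` has enormous image** (ACC+ Def. 6.2.28), for `k` algebraically closed whose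
units have finite order prime to `p` (e.g. `k = 𝔽̄_p`).  By the monomial normal form
(`exists_monomial_of_isDihedralType_of_not_hasCommonEigenvector`: `P r P⁻¹` is diagonal on an
index-two subgroup `G'`, antidiagonal off it, with some `diag(a, b)`, `a ≠ b`, on `G'`), the
conjugate `P r(G) P⁻¹` is enormous (`isEnormous_range_of_monomial`), and enormousness only depends
on the image in `PGL₂(k)` up to conjugation (the tree's
`isEnormous_of_forall_exists_eq_scalar_mul_conj`, ACC+ remark after Def. 6.2.28).  This is the
"image of `r̄|_{G_{F(ζ_l)}}` is enormous" input of Qian 2023, Thm. 1.4 in the projectively dihedral,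
`l ∤ |image|` case. [cite: ACCGHLNSTT2023, Def. 6.2.28] -/
theorem isEnormous_range_of_isDihedralType (hp2 : p ≠ 2)
    (htor : ∀ a : kˣ, ∃ m : ℕ, ¬ p ∣ m ∧ a ^ m = 1)
    (r : G →* GL (Fin 2) k) [Finite r.range] (hcard : ¬ p ∣ Nat.card r.range)
    (hirr : IsAbsIrreducible r) (hdih : IsDihedralType r) : Subgroup.IsEnormous r.range := by
  have hce : ¬ HasCommonEigenvector r := by
    refine not_hasCommonEigenvector_of_isIrreducible r ?_
    have h1 := hirr k (RingHom.id k)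
    have e : (Matrix.GeneralLinearGroup.map (RingHom.id k)).comp r = r := by ext g i j; simp
    rwa [e] at h1
  obtain ⟨G', P, hidx, hDg, hAd, h₀, hh₀, hab⟩ :=
    exists_monomial_of_isDihedralType_of_not_hasCommonEigenvector r hce hdih
  -- an element outside `G'`
  obtain ⟨g₀, hg₀⟩ : ∃ g₀, g₀ ∉ G' := by
    by_contra! hall
    have htop : G' = ⊤ := eq_top_iff.2 fun x _ ↦ hall x
    rw [htop, Subgroup.index_top] at hidx
    exact absurd hidx (by decide)
  set r' := conjGL P r with hr'
  -- `r'(G) = P r(G) P⁻¹` is finite of the same order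
  have hrange : r'.range = r.range.map (MulAut.conj P).toMonoidHom := MonoidHom.range_comp _ _
  haveI : Finite r'.range := by
    rw [hrange]
    exact Finite.of_equiv _ (r.range.equivMapOfInjective _ (MulAut.conj P).injective).toEquiv
  have hcard' : ¬ p ∣ Nat.card r'.range := by
    rwa [hrange, Subgroup.card_map_of_injective (MulAut.conj P).injective]
  have hen' : Subgroup.IsEnormous r'.range :=
    isEnormous_range_of_monomial hp2 r' hcard' G' hDg hAd hh₀ hab hg₀
  refine isEnormous_of_forall_exists_eq_scalar_mul_conj htor P⁻¹ (H' := r'.range) ?_ ?_ hen'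
  · rintro _ ⟨g, rfl⟩
    refine ⟨r' g, ⟨g, rfl⟩, 1, ?_⟩
    rw [map_one, one_mul, hr', conjGL_apply, inv_inv]
    group
  · rintro _ ⟨g, rfl⟩
    refine ⟨r g, ⟨g, rfl⟩, 1, ?_⟩
    rw [map_one, one_mul, conjGL_apply, inv_inv]
    group

/-- **Registered sub-goal `stub_enormousResidualPackage_enormousOfDihedral` of stub
`stub_enormousResidualPackage`** (crux stmt-Langlands-17009, line `merged`): the statement of
`isEnormous_range_of_isDihedralType` as a closed formula. [cite: ACCGHLNSTT2023, Def. 6.2.28] -/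
theorem stub_enormousResidualPackage_enormousOfDihedral : ∀ (k : Type) [Field k] [IsAlgClosed k] (p : ℕ) [Fact p.Prime] [CharP k p], p ≠ 2 → (∀ a : kˣ, ∃ m : ℕ, ¬ p ∣ m ∧ a ^ m = 1) → ∀ (G : Type) [Group G] (r : G →* GL (Fin 2) k), Finite r.range → ¬ p ∣ Nat.card r.range → IsAbsIrreducible r → IsDihedralType r → Subgroup.IsEnormous r.range := by
  intro k _ _ p _ _ hp2 htor G _ r hfin hcard hirr hdih
  exact isEnormous_range_of_isDihedralType hp2 htor r hcard hirr hdih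

end Dihedral

end Summit.Langlands.Langlands.Theorems.TensorSquareParallel

end
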